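import Summits.NavierStokesRegularity.FluidComputer.BlowupAnatomy
import Summits.NavierStokesRegularity.FluidComputer.DatumFace
import Summits.NavierStokesRegularity.FluidComputer.CriticalFace
import HarnessLib

/-!
# Fluid computer — the anatomy and the datum face READ ON THE INTERFACE: every cascade witness has a focus,
# divergent Serrin/BKM integrals, incoherent vortex lines, and a datum above the floors

HONEST FRAMING (cell `pub-fluidc`, verbatim): *low prior, high value-of-information experiment on Tao's
machine paradigm; NOT a claim that NS blows up.* An implication from the cell's (uninhabited, as far as anyone
knows) interface structure `CascadeWitness`; nothing here is evidence of blow-up. Companion of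
`CascadeWitnessFloor`, `CascadeWitnessClock` and `CriticalFace.critical_face_of_cascadeWitness`.

* `blowup_anatomy_of_cascadeWitness` — every `W : CascadeWitness` yields (via `x5a_of_cascadeWitness'`) `ν > 0`,
  `T > 0` and a maximal smooth Leray–Hopf solution `(u, p)` with: (S) `∫_{(t₀,T)} ‖u‖_∞² = ∞` and (B)
  `∫_{(t₀,T)} sup|curl u| = ∞` on every terminal window; (CF) vorticity-direction incoherence for all `Ω, ρ, t₀`;
  (F) a focus `x₀` (singular point) carrying the CKN `ε` at every scale (`BlowupAnatomy.blowup_anatomy`).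
* `datum_face_of_cascadeWitness` — and its datum, rapidly decaying hence bounded, clears the datum floors
  unconditionally: `c₁ν³ ≤ Z(0)²T`, `4c₂ν⁵T ≤ ‖u(0)‖₂⁴`, `4c₁c₂ν⁸ ≤ Z(0)²‖u(0)‖₂⁴`, `δν < ‖u(0)‖_{L³}`
  (`DatumFace.datum_face`, `CriticalFace.exists_bound_of_hasRapidSpatialDecay`).

0 sorry; no new definitions, no named facts.

## References

* J. Leray, Acta Math. 63 (1934) 193–248. [Leray1934]
* L. Caffarelli, R. Kohn, L. Nirenberg, Comm. Pure Appl. Math. 35 (1982). [CKN1982]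
* P. Constantin, C. Fefferman, Indiana Univ. Math. J. 42 (1993). [ConstantinFeffermanIndiana1993]
-/

noncomputable section

open MeasureTheory Set Function Filter Topology Metric
open scoped ENNReal NNReal
open Literature.Analysis.FluidPDE Literature.Analysis.FunctionSpaces Literature.Analysis.FluidPDE.FluidComputer
open Summit.NavierStokesRegularity.NavierStokesRegularity.Theorems.FluidComputer (x5a_of_cascadeWitness')
open Summit.NavierStokesRegularity.FluidComputer.BlowupAnatomy
open Summit.NavierStokesRegularity.FluidComputer.DatumFace
open Summit.NavierStokesRegularity.FluidComputer.CriticalFace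

namespace Summit.NavierStokesRegularity.FluidComputer.CascadeWitnessAnatomy

/-- **Every cascade witness has the anatomy of a blow-up.** With the absolute `ε` of `BlowupAnatomy.blowup_anatomy`:
every `W : CascadeWitness` yields `ν > 0`, `T > 0` and a maximal smooth solution `(u, p)` of the unforced
Navier–Stokes system on `ℝ³ × [0, T)`, Leray–Hopf from `u 0`, such that (S)/(B) the Serrin `L²_tL^∞_x` and the
Beale–Kato–Majda integrals diverge on every terminal window, (CF) the vorticity direction is not `ρ⁻¹`-coherent over
`{‖curl u‖ > Ω}` on any `[t₀, T)`, and (F) there is a focus `x₀` at which `u` is unbounded on every backward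
parabolic neighbourhood and the CKN floor `ε ≤ cknC ρ + cknD ρ` holds at every scale for the viscosity-normalised
solution. [cite: CKN1982, Prop. 1] [cite: ConstantinFeffermanIndiana1993, Theorem (§1)] -/
theorem blowup_anatomy_of_cascadeWitness :
    ∃ ε : ℝ, 0 < ε ∧ ∀ W : CascadeWitness, ∃ ν : ℝ, 0 < ν ∧ ∃ T : ℝ, 0 < T ∧
      ∃ (u : ℝ → EuclideanSpace ℝ (Fin 3) → EuclideanSpace ℝ (Fin 3))
        (p : ℝ → EuclideanSpace ℝ (Fin 3) → ℝ),
        IsMaximalSmoothSolution ν 0 u p T ∧ IsLerayHopfOn T ν 0 (u 0) u ∧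
        (∀ t₀ ∈ Ico 0 T, (∫⁻ s in Ioo t₀ T, eLpNorm (u s) ∞ volume ^ 2) = ∞ ∧
          (∫⁻ t in Ioo t₀ T, ⨆ x, ‖curl (u t) x‖ₑ) = ∞) ∧
        (∀ (Ω ρ t₀ : ℝ), 0 < Ω → 0 < ρ → t₀ ∈ Ico 0 T →
          ¬ (∀ t ∈ Ico t₀ T, ∀ x y : EuclideanSpace ℝ (Fin 3), Ω < ‖curl (u t) x‖ → Ω < ‖curl (u t) y‖ →
            Real.sqrt (1 - inner ℝ (vorticityDirection (curl (u t)) x) (vorticityDirection (curl (u t)) y) ^ 2) ≤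
              ‖x - y‖ / ρ)) ∧
        ∃ x₀ : EuclideanSpace ℝ (Fin 3),
          (∀ r : ℝ, 0 < r → ∀ M : ℝ, ∃ t ∈ Ioo (T - r ^ 2) T, 0 < t ∧ ∃ x ∈ ball x₀ r, M < ‖u t x‖) ∧
          ∀ ρ : ℝ, 0 < ρ → ρ ^ 2 < T * ν →
            ENNReal.ofReal ε ≤
              cknC ρ ((T * ν : ℝ), x₀) (timeRescale ν⁻¹ ν⁻¹ u) +
              cknD ρ ((T * ν : ℝ), x₀) (fun s x => timeRescale ν⁻¹ (ν⁻¹ ^ 2) p s x -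
                (timeRescale ν⁻¹ (ν⁻¹ ^ 2) p s 0 - normalisedPressure (timeRescale ν⁻¹ ν⁻¹ u s) 0)) := by
  obtain ⟨ε, hε, H⟩ := blowup_anatomy
  refine ⟨ε, hε, fun W => ?_⟩
  obtain ⟨ν, hν, T, hT, u, p, hmax, hLH, -⟩ := x5a_of_cascadeWitness' W
  exact ⟨ν, hν, T, hT, u, p, hmax, hLH, H ν T hν hT u p hmax hLH⟩

/-- **The datum of every cascade witness clears the datum floors.** With the absolute `c₁, c₂, δ` of
`DatumFace.datum_face`: every `W : CascadeWitness` yields `ν > 0`, `T > 0` and a maximal smooth Leray–Hopf solution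
`(u, p)` with `c₁ν³ ≤ (∫|∇u(0)|²)² T`, `4c₂ν⁵T ≤ ‖u(0)‖₂⁴`, `4c₁c₂ν⁸ ≤ (∫|∇u(0)|²)²‖u(0)‖₂⁴` and — the datum being
rapidly decaying, hence bounded — `δν < ‖u(0)‖_{L³}` unconditionally.
[cite: Leray1934, §20 and §34] -/
theorem datum_face_of_cascadeWitness :
    ∃ c₁ c₂ δ : ℝ, 0 < c₁ ∧ 0 < c₂ ∧ 0 < δ ∧ ∀ W : CascadeWitness, ∃ ν : ℝ, 0 < ν ∧ ∃ T : ℝ, 0 < T ∧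
      ∃ (u : ℝ → EuclideanSpace ℝ (Fin 3) → EuclideanSpace ℝ (Fin 3))
        (p : ℝ → EuclideanSpace ℝ (Fin 3) → ℝ),
        IsMaximalSmoothSolution ν 0 u p T ∧ IsLerayHopfOn T ν 0 (u 0) u ∧
        ENNReal.ofReal (c₁ * ν ^ 3) ≤
            (∫⁻ x, ENNReal.ofReal (frobeniusNormSq (fderiv ℝ (u 0) x))) ^ 2 * ENNReal.ofReal T ∧
        4 * c₂ * ν ^ 5 * T ≤ (eLpNorm (u 0) 2 volume).toReal ^ 4 ∧
        ENNReal.ofReal (4 * c₁ * c₂ * ν ^ 8) ≤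
            (∫⁻ x, ENNReal.ofReal (frobeniusNormSq (fderiv ℝ (u 0) x))) ^ 2 * eLpNorm (u 0) 2 volume ^ 4 ∧
        ENNReal.ofReal (δ * ν) < eLpNorm (u 0) 3 volume := by
  obtain ⟨c₁, c₂, δ, hc₁, hc₂, hδ, H⟩ := datum_face
  refine ⟨c₁, c₂, δ, hc₁, hc₂, hδ, fun W => ?_⟩
  obtain ⟨ν, hν, T, hT, u, p, hmax, hLH, hdec⟩ := x5a_of_cascadeWitness' W
  obtain ⟨hZ, hE, hP, hK⟩ := H ν T hν hT u p hmax hLH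
  exact ⟨ν, hν, T, hT, u, p, hmax, hLH, hZ, hE, hP, hK (exists_bound_of_hasRapidSpatialDecay hdec)⟩

end Summit.NavierStokesRegularity.FluidComputer.CascadeWitnessAnatomy

end
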